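import Literature.AlgebraicGeometry.HodgeTheory.RibetTypeTenPowersHodgeClasses
import Literature.AlgebraicGeometry.HodgeTheory.RibetTypeCoprimeMinLeFourPowersHodgeClasses
import Literature.AlgebraicGeometry.Motives.HodgeThetaSubalgebraUnitaryTwelveThirteenCore
import HarnessLib

/-!
# Hodge classes on all powers of abelian varieties of Ribet type `(11, n″)`, `11 ∤ n″`, and `(13, n″)`, `13 ∤ n″` —
# ALL of them — and `(9, n″)`, `n″ ∈ {1,2,4,5,7,11,13}`, `(12, 13)`, are generated by divisor classes
# (Ribet 1983 Thm. 3 at these multiplicities — UNCONDITIONAL; `23 = 11 + 12`, `25`-folds `{12, 13}`)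

Family `hodge`, layer `Literature/AlgebraicGeometry/HodgeTheory`. Research context: cell `pub-hodge-ring2` (HONEST
FRAMING: research route conditional on HC_CM; not a corollary; Q11.4-sentence-2 already refuted in dim ≥ 3),
Literature lane gen 84, programme R69. UNCONDITIONAL for the class of abelian varieties it names; theorems only, no
definition, no named fact (D-0026), no `sorry`. The CELLS of the generic assembly `RibetTypeOfCoreSmulPowersHodgeClasses`
at the cores `UnitaryEleven.eq_top_of_smul`, `UnitaryThirteen.eq_top_of_smul` (every second multiplicity prime to
`11`, resp. `13`), `UnitaryNine.eq_top_of_smul`, `UnitaryTwelve.eq_top_thirteen`, and the census they refine: in prime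
dimension `p ≥ 11` the imaginary-quadratic residual of `TankeevRibet1983_hodgeClasses_divisorial_powers_simplePrimeDimension`
is `min(n′, n″) ≥ 8` with `n′, n″ ∉ {11, 13}` (dimension `17`: `{8,9}`; `19`: `{9,10}`; `23`: `{8,15}`, `{9,14}`;
`29`: `{8,21}`, `{9,20}`, `{10,19}`, `{12,17}`, `{14,15}`).

THE PRINTED THEOREM. Ribet, Amer. J. Math. 105 (1983), Thm. 3 = Gordon's survey Thm. 6.3 (3) [held
`paper:arxiv-alg-geom_9709030` p. 18].

## References
* [Ribet1983] K. A. Ribet, Amer. J. Math. 105 (1983), Thm. 0 and Thm. 3.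
* [Gordon1997] B. B. Gordon, *A survey of the Hodge conjecture for abelian varieties*, Thm. 6.3 (3) and Corollary.
* [MoonenZarhin1999LowDim] B. Moonen, Yu. Zarhin, Math. Ann. 315 (1999), §2 (2.4), Thm. (2.7).
* [Deligne2000] P. Deligne, *The Hodge conjecture* (Clay, 2000), §1.
-/

noncomputable section

open CategoryTheory Module

namespace Literature.AlgebraicGeometry.HodgeTheory

open Literature.AlgebraicGeometry.Motives
open Literature.AlgebraicGeometry.Motives.HodgeStructure

section Cells

/-- **Ribet 1983 Thm. 3 at `(11, n″)`, EVERY `n″` prime to `11` — UNCONDITIONAL: `B•(A^{N+1}) = D•(A^{N+1}) ⊗ ℂ`**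
(`φ ≫ φ = -d`, `finrank_ℚ End⁰(A) = 2`, `n_{i√d}(φ) = 11`, `11 ∤ n_{−i√d}(φ) ≠ 0`; core `UnitaryEleven.eq_top_of_smul`).
[cite: Ribet1983, Thm. 0 and Thm. 3] [cite: Gordon1997, Thm. 6.3 (3) and Corollary] -/
theorem AbelianVariety.isDivisorGenerated_powSucc_of_ribetTypeEleven (A : AbelianVariety ℂ) (φ : A ⟶ A)
    {d : ℕ} (hd : 0 < d) (hφ : φ ≫ φ = -(d • 𝟙 A)) (hE2 : Module.finrank ℚ A.endAlgebra = 2)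
    (h11 : eigenMultiplicity A φ (Complex.I * (Real.sqrt d : ℂ)) = 11)
    (hpos' : 0 < eigenMultiplicity A φ (-(Complex.I * (Real.sqrt d : ℂ))))
    (h11' : ¬ 11 ∣ eigenMultiplicity A φ (-(Complex.I * (Real.sqrt d : ℂ)))) (N : ℕ) :
    IsDivisorGenerated (A.powSucc N) := by
  refine AbelianVariety.isDivisorGenerated_powSucc_of_ribetType_ofCoreSmul A φ hd hφ hE2 (by omega) hpos' ?_ N
  intro W' _ _ _ 𝔊 ι P' Q' s hbr hirr hι hιι hP' hQ' hfinP' hfinQ' hadd hsmul hsymm hPQ hdefP hdefQ hadj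
  exact UnitaryEleven.eq_top_of_smul hbr hirr hι hιι hP' hQ' (by rw [hfinP', h11]) (by rw [hfinQ']; exact h11')
    hadd hsmul hsymm hPQ hdefP hdefQ hadj

/-- The mirror: `11 ∤ n_{i√d}(φ) ≠ 0`, `n_{−i√d}(φ) = 11` (core `UnitaryEleven.eq_top_of_smul'`).
[cite: Ribet1983, Thm. 0 and Thm. 3] [cite: Gordon1997, Thm. 6.3 (3) and Corollary] -/
theorem AbelianVariety.isDivisorGenerated_powSucc_of_ribetTypeEleven' (A : AbelianVariety ℂ) (φ : A ⟶ A)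
    {d : ℕ} (hd : 0 < d) (hφ : φ ≫ φ = -(d • 𝟙 A)) (hE2 : Module.finrank ℚ A.endAlgebra = 2)
    (hpos : 0 < eigenMultiplicity A φ (Complex.I * (Real.sqrt d : ℂ)))
    (h11' : ¬ 11 ∣ eigenMultiplicity A φ (Complex.I * (Real.sqrt d : ℂ)))
    (h11 : eigenMultiplicity A φ (-(Complex.I * (Real.sqrt d : ℂ))) = 11) (N : ℕ) :
    IsDivisorGenerated (A.powSucc N) := by
  refine AbelianVariety.isDivisorGenerated_powSucc_of_ribetType_ofCoreSmul A φ hd hφ hE2 hpos (by omega) ?_ N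
  intro W' _ _ _ 𝔊 ι P' Q' s hbr hirr hι hιι hP' hQ' hfinP' hfinQ' hadd hsmul hsymm hPQ hdefP hdefQ hadj
  exact UnitaryEleven.eq_top_of_smul' hbr hirr hι hιι hP' hQ' (by rw [hfinP']; exact h11') (by rw [hfinQ', h11])
    hadd hsmul hsymm hPQ hdefP hdefQ hadj

/-- **Ribet 1983 Thm. 3 at `(13, n″)`, EVERY `n″` prime to `13` — UNCONDITIONAL** (core `UnitaryThirteen.eq_top_of_smul`).
[cite: Ribet1983, Thm. 0 and Thm. 3] [cite: Gordon1997, Thm. 6.3 (3) and Corollary] -/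
theorem AbelianVariety.isDivisorGenerated_powSucc_of_ribetTypeThirteen (A : AbelianVariety ℂ) (φ : A ⟶ A)
    {d : ℕ} (hd : 0 < d) (hφ : φ ≫ φ = -(d • 𝟙 A)) (hE2 : Module.finrank ℚ A.endAlgebra = 2)
    (h13 : eigenMultiplicity A φ (Complex.I * (Real.sqrt d : ℂ)) = 13)
    (hpos' : 0 < eigenMultiplicity A φ (-(Complex.I * (Real.sqrt d : ℂ))))
    (h13' : ¬ 13 ∣ eigenMultiplicity A φ (-(Complex.I * (Real.sqrt d : ℂ)))) (N : ℕ) :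
    IsDivisorGenerated (A.powSucc N) := by
  refine AbelianVariety.isDivisorGenerated_powSucc_of_ribetType_ofCoreSmul A φ hd hφ hE2 (by omega) hpos' ?_ N
  intro W' _ _ _ 𝔊 ι P' Q' s hbr hirr hι hιι hP' hQ' hfinP' hfinQ' hadd hsmul hsymm hPQ hdefP hdefQ hadj
  exact UnitaryThirteen.eq_top_of_smul hbr hirr hι hιι hP' hQ' (by rw [hfinP', h13]) (by rw [hfinQ']; exact h13')
    hadd hsmul hsymm hPQ hdefP hdefQ hadj

/-- The mirror: `13 ∤ n_{i√d}(φ) ≠ 0`, `n_{−i√d}(φ) = 13` (core `UnitaryThirteen.eq_top_of_smul'`).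
[cite: Ribet1983, Thm. 0 and Thm. 3] [cite: Gordon1997, Thm. 6.3 (3) and Corollary] -/
theorem AbelianVariety.isDivisorGenerated_powSucc_of_ribetTypeThirteen' (A : AbelianVariety ℂ) (φ : A ⟶ A)
    {d : ℕ} (hd : 0 < d) (hφ : φ ≫ φ = -(d • 𝟙 A)) (hE2 : Module.finrank ℚ A.endAlgebra = 2)
    (hpos : 0 < eigenMultiplicity A φ (Complex.I * (Real.sqrt d : ℂ)))
    (h13' : ¬ 13 ∣ eigenMultiplicity A φ (Complex.I * (Real.sqrt d : ℂ)))
    (h13 : eigenMultiplicity A φ (-(Complex.I * (Real.sqrt d : ℂ))) = 13) (N : ℕ) :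
    IsDivisorGenerated (A.powSucc N) := by
  refine AbelianVariety.isDivisorGenerated_powSucc_of_ribetType_ofCoreSmul A φ hd hφ hE2 hpos (by omega) ?_ N
  intro W' _ _ _ 𝔊 ι P' Q' s hbr hirr hι hιι hP' hQ' hfinP' hfinQ' hadd hsmul hsymm hPQ hdefP hdefQ hadj
  exact UnitaryThirteen.eq_top_of_smul' hbr hirr hι hιι hP' hQ' (by rw [hfinP']; exact h13') (by rw [hfinQ', h13])
    hadd hsmul hsymm hPQ hdefP hdefQ hadj

/-- **Ribet 1983 Thm. 3 at `(9, n″)`, `n″ ∈ {1, 2, 4, 5, 7, 11, 13}` — UNCONDITIONAL** (core `UnitaryNine.eq_top_of_smul`).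
[cite: Ribet1983, Thm. 0 and Thm. 3] [cite: Gordon1997, Thm. 6.3 (3) and Corollary] -/
theorem AbelianVariety.isDivisorGenerated_powSucc_of_ribetTypeNine (A : AbelianVariety ℂ) (φ : A ⟶ A)
    {d : ℕ} (hd : 0 < d) (hφ : φ ≫ φ = -(d • 𝟙 A)) (hE2 : Module.finrank ℚ A.endAlgebra = 2)
    (h9 : eigenMultiplicity A φ (Complex.I * (Real.sqrt d : ℂ)) = 9)
    (hpos' : 0 < eigenMultiplicity A φ (-(Complex.I * (Real.sqrt d : ℂ))))
    (h13 : eigenMultiplicity A φ (-(Complex.I * (Real.sqrt d : ℂ))) ≤ 13)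
    (h3 : ¬ 3 ∣ eigenMultiplicity A φ (-(Complex.I * (Real.sqrt d : ℂ))))
    (h8 : eigenMultiplicity A φ (-(Complex.I * (Real.sqrt d : ℂ))) ≠ 8)
    (h10 : eigenMultiplicity A φ (-(Complex.I * (Real.sqrt d : ℂ))) ≠ 10) (N : ℕ) :
    IsDivisorGenerated (A.powSucc N) := by
  refine AbelianVariety.isDivisorGenerated_powSucc_of_ribetType_ofCoreSmul A φ hd hφ hE2 (by omega) hpos' ?_ N
  intro W' _ _ _ 𝔊 ι P' Q' s hbr hirr hι hιι hP' hQ' hfinP' hfinQ' hadd hsmul hsymm hPQ hdefP hdefQ hadj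
  exact UnitaryNine.eq_top_of_smul hbr hirr hι hιι hP' hQ' (by rw [hfinP', h9]) (by rw [hfinQ']; exact h13)
    (by rw [hfinQ']; exact h3) (by rw [hfinQ']; exact h8) (by rw [hfinQ']; exact h10) hadd hsmul hsymm hPQ hdefP
    hdefQ hadj

/-- The mirror `(n′, 9)`, `n′ ∈ {1, 2, 4, 5, 7, 11, 13}` (core `UnitaryNine.eq_top_of_smul'`).
[cite: Ribet1983, Thm. 0 and Thm. 3] [cite: Gordon1997, Thm. 6.3 (3) and Corollary] -/
theorem AbelianVariety.isDivisorGenerated_powSucc_of_ribetTypeNine' (A : AbelianVariety ℂ) (φ : A ⟶ A)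
    {d : ℕ} (hd : 0 < d) (hφ : φ ≫ φ = -(d • 𝟙 A)) (hE2 : Module.finrank ℚ A.endAlgebra = 2)
    (hpos : 0 < eigenMultiplicity A φ (Complex.I * (Real.sqrt d : ℂ)))
    (h13 : eigenMultiplicity A φ (Complex.I * (Real.sqrt d : ℂ)) ≤ 13)
    (h3 : ¬ 3 ∣ eigenMultiplicity A φ (Complex.I * (Real.sqrt d : ℂ)))
    (h8 : eigenMultiplicity A φ (Complex.I * (Real.sqrt d : ℂ)) ≠ 8)
    (h10 : eigenMultiplicity A φ (Complex.I * (Real.sqrt d : ℂ)) ≠ 10)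
    (h9 : eigenMultiplicity A φ (-(Complex.I * (Real.sqrt d : ℂ))) = 9) (N : ℕ) :
    IsDivisorGenerated (A.powSucc N) := by
  refine AbelianVariety.isDivisorGenerated_powSucc_of_ribetType_ofCoreSmul A φ hd hφ hE2 hpos (by omega) ?_ N
  intro W' _ _ _ 𝔊 ι P' Q' s hbr hirr hι hιι hP' hQ' hfinP' hfinQ' hadd hsmul hsymm hPQ hdefP hdefQ hadj
  exact UnitaryNine.eq_top_of_smul' hbr hirr hι hιι hP' hQ' (by rw [hfinP']; exact h13) (by rw [hfinP']; exact h3)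
    (by rw [hfinP']; exact h8) (by rw [hfinP']; exact h10) (by rw [hfinQ', h9]) hadd hsmul hsymm hPQ hdefP hdefQ hadj

/-- **Ribet 1983 Thm. 3 at `(12, 13)` and `(13, 12)` — UNCONDITIONAL** (e.g. `25`-folds `{12, 13}`; cores
`UnitaryTwelve.eq_top_thirteen`, `eq_top_thirteen'`). [cite: Ribet1983, Thm. 0 and Thm. 3] [cite: Gordon1997, Thm. 6.3 (3) and Corollary] -/
theorem AbelianVariety.isDivisorGenerated_powSucc_of_ribetTypeTwelveThirteen (A : AbelianVariety ℂ) (φ : A ⟶ A)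
    {d : ℕ} (hd : 0 < d) (hφ : φ ≫ φ = -(d • 𝟙 A)) (hE2 : Module.finrank ℚ A.endAlgebra = 2)
    (h : (eigenMultiplicity A φ (Complex.I * (Real.sqrt d : ℂ)) = 12 ∧
        eigenMultiplicity A φ (-(Complex.I * (Real.sqrt d : ℂ))) = 13) ∨
      (eigenMultiplicity A φ (Complex.I * (Real.sqrt d : ℂ)) = 13 ∧
        eigenMultiplicity A φ (-(Complex.I * (Real.sqrt d : ℂ))) = 12)) (N : ℕ) :
    IsDivisorGenerated (A.powSucc N) := by
  rcases h with ⟨h12, h13⟩ | ⟨h13, h12⟩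
  · refine AbelianVariety.isDivisorGenerated_powSucc_of_ribetType_ofCoreSmul A φ hd hφ hE2 (by omega) (by omega) ?_ N
    intro W' _ _ _ 𝔊 ι P' Q' s hbr hirr hι hιι hP' hQ' hfinP' hfinQ' hadd hsmul hsymm hPQ hdefP hdefQ hadj
    exact UnitaryTwelve.eq_top_thirteen hbr hirr hι hιι hP' hQ' (by rw [hfinP', h12]) (by rw [hfinQ', h13])
      hadd hsmul hsymm hPQ hdefP hdefQ hadj
  · refine AbelianVariety.isDivisorGenerated_powSucc_of_ribetType_ofCoreSmul A φ hd hφ hE2 (by omega) (by omega) ?_ N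
    intro W' _ _ _ 𝔊 ι P' Q' s hbr hirr hι hιι hP' hQ' hfinP' hfinQ' hadd hsmul hsymm hPQ hdefP hdefQ hadj
    exact UnitaryTwelve.eq_top_thirteen' hbr hirr hι hιι hP' hQ' (by rw [hfinP', h13]) (by rw [hfinQ', h12])
      hadd hsmul hsymm hPQ hdefP hdefQ hadj

/-- **The Hodge conjecture for all powers of an abelian variety of unitary type `(11, n″)`, `11 ∤ n″` — UNCONDITIONAL**
(e.g. `23`-FOLDS `{11,12}`). [cite: Ribet1983, Thm. 3] [cite: Deligne2000, §1] -/
theorem hodgeConjectureFor_powSucc_of_ribetTypeEleven (A : AbelianVariety ℂ) (φ : A ⟶ A)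
    {d : ℕ} (hd : 0 < d) (hφ : φ ≫ φ = -(d • 𝟙 A)) (hE2 : Module.finrank ℚ A.endAlgebra = 2)
    (h11 : eigenMultiplicity A φ (Complex.I * (Real.sqrt d : ℂ)) = 11)
    (hpos' : 0 < eigenMultiplicity A φ (-(Complex.I * (Real.sqrt d : ℂ))))
    (h11' : ¬ 11 ∣ eigenMultiplicity A φ (-(Complex.I * (Real.sqrt d : ℂ)))) (N : ℕ) :
    HodgeConjectureFor (A.powSucc N).dim (A.powSucc N).X :=
  hodgeConjectureFor_of_isDivisorGenerated _
    (AbelianVariety.isDivisorGenerated_powSucc_of_ribetTypeEleven A φ hd hφ hE2 h11 hpos' h11' N)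

/-- **The Hodge conjecture for all powers of an abelian variety of unitary type `(13, n″)`, `13 ∤ n″` — UNCONDITIONAL.**
[cite: Ribet1983, Thm. 3] [cite: Deligne2000, §1] -/
theorem hodgeConjectureFor_powSucc_of_ribetTypeThirteen (A : AbelianVariety ℂ) (φ : A ⟶ A)
    {d : ℕ} (hd : 0 < d) (hφ : φ ≫ φ = -(d • 𝟙 A)) (hE2 : Module.finrank ℚ A.endAlgebra = 2)
    (h13 : eigenMultiplicity A φ (Complex.I * (Real.sqrt d : ℂ)) = 13)
    (hpos' : 0 < eigenMultiplicity A φ (-(Complex.I * (Real.sqrt d : ℂ))))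
    (h13' : ¬ 13 ∣ eigenMultiplicity A φ (-(Complex.I * (Real.sqrt d : ℂ)))) (N : ℕ) :
    HodgeConjectureFor (A.powSucc N).dim (A.powSucc N).X :=
  hodgeConjectureFor_of_isDivisorGenerated _
    (AbelianVariety.isDivisorGenerated_powSucc_of_ribetTypeThirteen A φ hd hφ hE2 h13 hpos' h13' N)

/-- **`23`-FOLDS of signature `{11, 12}`: `B• = D•` on all powers — UNCONDITIONAL.**
[cite: Ribet1983, Thm. 0 and Thm. 3] [cite: MoonenZarhin1999LowDim, §2 (2.4)] -/
theorem AbelianVariety.isDivisorGenerated_powSucc_of_twentythreefold_elevenTwelve (A : AbelianVariety ℂ)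
    (φ : A ⟶ A) {d : ℕ} (hd : 0 < d) (hφ : φ ≫ φ = -(d • 𝟙 A)) (hE2 : Module.finrank ℚ A.endAlgebra = 2)
    (hX : A.dim = 23)
    (h11 : eigenMultiplicity A φ (Complex.I * (Real.sqrt d : ℂ)) = 11 ∨ eigenMultiplicity A φ (-(Complex.I * (Real.sqrt d : ℂ))) = 11)
    (N : ℕ) : IsDivisorGenerated (A.powSucc N) := by
  have hsum := eigenMultiplicity_add_eigenMultiplicity_neg_eq_dim A φ hd hφ
  rw [hX] at hsum
  rcases h11 with h | h
  · exact AbelianVariety.isDivisorGenerated_powSucc_of_ribetTypeEleven A φ hd hφ hE2 h (by omega) (by omega) N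
  · exact AbelianVariety.isDivisorGenerated_powSucc_of_ribetTypeEleven' A φ hd hφ hE2 (by omega) (by omega) h N

/-- **The Hodge conjecture for all powers of a `23`-FOLD of signature `{11, 12}` — UNCONDITIONAL.**
[cite: Ribet1983, Thm. 3] [cite: Deligne2000, §1] -/
theorem hodgeConjectureFor_powSucc_of_twentythreefold_elevenTwelve (A : AbelianVariety ℂ)
    (φ : A ⟶ A) {d : ℕ} (hd : 0 < d) (hφ : φ ≫ φ = -(d • 𝟙 A)) (hE2 : Module.finrank ℚ A.endAlgebra = 2)
    (hX : A.dim = 23)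
    (h11 : eigenMultiplicity A φ (Complex.I * (Real.sqrt d : ℂ)) = 11 ∨ eigenMultiplicity A φ (-(Complex.I * (Real.sqrt d : ℂ))) = 11)
    (N : ℕ) : HodgeConjectureFor (A.powSucc N).dim (A.powSucc N).X :=
  hodgeConjectureFor_of_isDivisorGenerated _
    (AbelianVariety.isDivisorGenerated_powSucc_of_twentythreefold_elevenTwelve A φ hd hφ hE2 hX h11 N)

end Cells

/-! ### Census: the Tankeev–Ribet residual is `min(n′, n″) ≥ 8`, `n′, n″ ∉ {11, 13}` -/

section Census

/-- **The Tankeev–Ribet fact is EQUIVALENT to: (S1) `End⁰ = ℚ` in prime dimension `≥ 11`, and (S2) imaginary-quadratic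
multiplicities both `≥ 8` and both `∉ {11, 13}`** (dimension `17`: only `{8,9}`; `19`: only `{9,10}`; `23`: `{8,15}`,
`{9,14}`; `29`: `{8,21}`, `{9,20}`, `{10,19}`, `{12,17}`, `{14,15}`). [cite: MoonenZarhin1999LowDim, §2 (2.4)–(2.7)]
[cite: Gordon1999HodgeAVSurvey, Thm. 6.3 and Corollary] [cite: Ribet1983, Thms. 1 and 3] -/
theorem tankeevRibet1983_iff_generic_ge_eleven_and_unitary_ge_eight_notin_eleven_thirteen :
    TankeevRibet1983_hodgeClasses_divisorial_powers_simplePrimeDimension ↔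
      (∀ X : AbelianVariety ℂ, X.dim.Prime → 11 ≤ X.dim → X.IsSimple → Module.finrank ℚ X.endAlgebra = 1 →
        ∀ N : ℕ, IsDivisorGenerated (X.powSucc N)) ∧
      (∀ (X : AbelianVariety ℂ) (φ : X ⟶ X) (d : ℕ), X.dim.Prime → X.IsSimple → 0 < d →
        φ ≫ φ = -(d • 𝟙 X) → Module.finrank ℚ X.endAlgebra = 2 →
        8 ≤ eigenMultiplicity X φ (Complex.I * (Real.sqrt d : ℂ)) →
        8 ≤ eigenMultiplicity X φ (-(Complex.I * (Real.sqrt d : ℂ))) →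
        eigenMultiplicity X φ (Complex.I * (Real.sqrt d : ℂ)) ≠ 11 →
        eigenMultiplicity X φ (-(Complex.I * (Real.sqrt d : ℂ))) ≠ 11 →
        eigenMultiplicity X φ (Complex.I * (Real.sqrt d : ℂ)) ≠ 13 →
        eigenMultiplicity X φ (-(Complex.I * (Real.sqrt d : ℂ))) ≠ 13 →
        ∀ N : ℕ, IsDivisorGenerated (X.powSucc N)) := by
  rw [tankeevRibet1983_iff_generic_ge_eleven_and_unitary_ge_eight_ne_eightEleven_tenThirteen]
  refine ⟨fun ⟨hS1, hS8⟩ => ⟨hS1, fun X φ d hp hs hd hφ he2 ha hb ha11 hb11 ha13 hb13 N =>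
    hS8 X φ d hp hs hd hφ he2 ha hb (fun h => hb11 h.2) (fun h => ha11 h.1) (fun h => hb13 h.2) (fun h => ha13 h.1) N⟩,
    fun ⟨hS1, hS8'⟩ => ⟨hS1, ?_⟩⟩
  intro X φ d hp hs hd hφ he2 ha hb _ _ _ _ N
  have hsum := eigenMultiplicity_add_eigenMultiplicity_neg_eq_dim X φ hd hφ
  -- the prime `X.dim ≥ 16` is divisible neither by `11` nor by `13`
  have h11dim : ¬ 11 ∣ X.dim := fun h => by have := Nat.Prime.eq_one_or_self_of_dvd hp 11 h; omega
  have h13dim : ¬ 13 ∣ X.dim := fun h => by have := Nat.Prime.eq_one_or_self_of_dvd hp 13 h; omega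
  by_cases ha11 : eigenMultiplicity X φ (Complex.I * (Real.sqrt d : ℂ)) = 11
  · exact AbelianVariety.isDivisorGenerated_powSucc_of_ribetTypeEleven X φ hd hφ he2 ha11 (by omega) (by omega) N
  by_cases hb11 : eigenMultiplicity X φ (-(Complex.I * (Real.sqrt d : ℂ))) = 11
  · exact AbelianVariety.isDivisorGenerated_powSucc_of_ribetTypeEleven' X φ hd hφ he2 (by omega) (by omega) hb11 N
  by_cases ha13 : eigenMultiplicity X φ (Complex.I * (Real.sqrt d : ℂ)) = 13
  · exact AbelianVariety.isDivisorGenerated_powSucc_of_ribetTypeThirteen X φ hd hφ he2 ha13 (by omega) (by omega) N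
  by_cases hb13 : eigenMultiplicity X φ (-(Complex.I * (Real.sqrt d : ℂ))) = 13
  · exact AbelianVariety.isDivisorGenerated_powSucc_of_ribetTypeThirteen' X φ hd hφ he2 (by omega) (by omega) hb13 N
  exact hS8' X φ d hp hs hd hφ he2 ha hb ha11 hb11 ha13 hb13 N

end Census

/-! ### One packaged statement: Ribet's Thm. 3 for coprime `(n′, n″)` with `min(n′, n″) ≤ 7` or a multiplicity in `{11, 13}` -/

section Packaged

/-- **Ribet 1983 Thm. 3, classification-free, as ONE citable statement — UNCONDITIONAL:** for `φ ≫ φ = -d`,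
`finrank_ℚ End⁰(A) = 2`, `dim A ≥ 3`, COPRIME multiplicities `(n′, n″)` with `min(n′, n″) ≤ 7` or `n′ ∈ {11, 13}` or
`n″ ∈ {11, 13}`, the Hodge classes on every power `A^{N+1}` are generated by divisor classes. (The tree's
`…_of_ribetType_coprime_min_le_four` extended by the `(5|·)`, `(6|·)`, `(7|·)`, `(11|·)`, `(13|·)` cells.)
[cite: Ribet1983, Thm. 0 and Thm. 3] [cite: Gordon1997, Thm. 6.3 (3) and Corollary] -/
theorem AbelianVariety.isDivisorGenerated_powSucc_of_ribetType_coprime_min_le_seven_or_mem (A : AbelianVariety ℂ)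
    (φ : A ⟶ A) {d : ℕ} (hd : 0 < d) (hφ : φ ≫ φ = -(d • 𝟙 A)) (hE2 : Module.finrank ℚ A.endAlgebra = 2)
    (hdim : 3 ≤ A.dim)
    (hcop : Nat.Coprime (eigenMultiplicity A φ (Complex.I * (Real.sqrt d : ℂ)))
      (eigenMultiplicity A φ (-(Complex.I * (Real.sqrt d : ℂ)))))
    (hmin : eigenMultiplicity A φ (Complex.I * (Real.sqrt d : ℂ)) ≤ 7 ∨
      eigenMultiplicity A φ (-(Complex.I * (Real.sqrt d : ℂ))) ≤ 7 ∨
      eigenMultiplicity A φ (Complex.I * (Real.sqrt d : ℂ)) = 11 ∨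
      eigenMultiplicity A φ (-(Complex.I * (Real.sqrt d : ℂ))) = 11 ∨
      eigenMultiplicity A φ (Complex.I * (Real.sqrt d : ℂ)) = 13 ∨
      eigenMultiplicity A φ (-(Complex.I * (Real.sqrt d : ℂ))) = 13) (N : ℕ) :
    IsDivisorGenerated (A.powSucc N) := by
  have hsum := eigenMultiplicity_add_eigenMultiplicity_neg_eq_dim A φ hd hφ
  have hn₁0 : eigenMultiplicity A φ (Complex.I * (Real.sqrt d : ℂ)) ≠ 0 := by
    intro h; rw [h, Nat.coprime_zero_left] at hcop; omega
  have hn₂0 : eigenMultiplicity A φ (-(Complex.I * (Real.sqrt d : ℂ))) ≠ 0 := by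
    intro h; rw [h, Nat.coprime_zero_right] at hcop; omega
  -- the shapes for the FIRST multiplicity `n′ = m`
  have key₁ : ∀ m : ℕ, eigenMultiplicity A φ (Complex.I * (Real.sqrt d : ℂ)) = m → (m ≤ 7 ∨ m = 11 ∨ m = 13) →
      IsDivisorGenerated (A.powSucc N) := by
    intro m hm hm'
    by_cases hm4 : m ≤ 4
    · exact AbelianVariety.isDivisorGenerated_powSucc_of_ribetType_coprime_min_le_four A φ hd hφ hE2 hdim hcop
        (Or.inl (by omega)) N
    have hc : Nat.Coprime m (eigenMultiplicity A φ (-(Complex.I * (Real.sqrt d : ℂ)))) := hm ▸ hcop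
    by_cases hm5 : m = 5
    · subst hm5
      exact AbelianVariety.isDivisorGenerated_powSucc_of_ribetTypeFiveAll A φ hd hφ hE2 hm
        ((Nat.Prime.coprime_iff_not_dvd Nat.prime_five).1 hc) N
    by_cases hm6 : m = 6
    · subst hm6
      have h2 : Nat.Coprime 2 (eigenMultiplicity A φ (-(Complex.I * (Real.sqrt d : ℂ)))) :=
        Nat.Coprime.coprime_dvd_left (by norm_num) hc
      have h3 : Nat.Coprime 3 (eigenMultiplicity A φ (-(Complex.I * (Real.sqrt d : ℂ)))) :=
        Nat.Coprime.coprime_dvd_left (by norm_num) hc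
      exact AbelianVariety.isDivisorGenerated_powSucc_of_ribetTypeSixAll A φ hd hφ hE2 hm (Nat.coprime_two_left.1 h2)
        ((Nat.Prime.coprime_iff_not_dvd Nat.prime_three).1 h3) N
    by_cases hm7 : m = 7
    · subst hm7
      exact AbelianVariety.isDivisorGenerated_powSucc_of_ribetTypeSevenAll A φ hd hφ hE2 hm
        ((Nat.Prime.coprime_iff_not_dvd (by norm_num)).1 hc) N
    by_cases hm11 : m = 11
    · subst hm11
      exact AbelianVariety.isDivisorGenerated_powSucc_of_ribetTypeEleven A φ hd hφ hE2 hm (by omega)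
        ((Nat.Prime.coprime_iff_not_dvd (by norm_num)).1 hc) N
    have hm13 : m = 13 := by omega
    subst hm13
    exact AbelianVariety.isDivisorGenerated_powSucc_of_ribetTypeThirteen A φ hd hφ hE2 hm (by omega)
      ((Nat.Prime.coprime_iff_not_dvd (by norm_num)).1 hc) N
  -- the shapes for the SECOND multiplicity `n″ = m`
  have key₂ : ∀ m : ℕ, eigenMultiplicity A φ (-(Complex.I * (Real.sqrt d : ℂ))) = m → (m ≤ 7 ∨ m = 11 ∨ m = 13) →
      IsDivisorGenerated (A.powSucc N) := by
    intro m hm hm'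
    by_cases hm4 : m ≤ 4
    · exact AbelianVariety.isDivisorGenerated_powSucc_of_ribetType_coprime_min_le_four A φ hd hφ hE2 hdim hcop
        (Or.inr (by omega)) N
    have hc : Nat.Coprime m (eigenMultiplicity A φ (Complex.I * (Real.sqrt d : ℂ))) := hm ▸ hcop.symm
    by_cases hm5 : m = 5
    · subst hm5
      exact AbelianVariety.isDivisorGenerated_powSucc_of_ribetTypeFiveAll' A φ hd hφ hE2
        ((Nat.Prime.coprime_iff_not_dvd Nat.prime_five).1 hc) hm N
    by_cases hm6 : m = 6
    · subst hm6
      have h2 : Nat.Coprime 2 (eigenMultiplicity A φ (Complex.I * (Real.sqrt d : ℂ))) :=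
        Nat.Coprime.coprime_dvd_left (by norm_num) hc
      have h3 : Nat.Coprime 3 (eigenMultiplicity A φ (Complex.I * (Real.sqrt d : ℂ))) :=
        Nat.Coprime.coprime_dvd_left (by norm_num) hc
      exact AbelianVariety.isDivisorGenerated_powSucc_of_ribetTypeSixAll' A φ hd hφ hE2 (Nat.coprime_two_left.1 h2)
        ((Nat.Prime.coprime_iff_not_dvd Nat.prime_three).1 h3) hm N
    by_cases hm7 : m = 7
    · subst hm7
      exact AbelianVariety.isDivisorGenerated_powSucc_of_ribetTypeSevenAll' A φ hd hφ hE2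
        ((Nat.Prime.coprime_iff_not_dvd (by norm_num)).1 hc) hm N
    by_cases hm11 : m = 11
    · subst hm11
      exact AbelianVariety.isDivisorGenerated_powSucc_of_ribetTypeEleven' A φ hd hφ hE2 (by omega)
        ((Nat.Prime.coprime_iff_not_dvd (by norm_num)).1 hc) hm N
    have hm13 : m = 13 := by omega
    subst hm13
    exact AbelianVariety.isDivisorGenerated_powSucc_of_ribetTypeThirteen' A φ hd hφ hE2 (by omega)
      ((Nat.Prime.coprime_iff_not_dvd (by norm_num)).1 hc) hm N
  rcases hmin with h | h | h | h | h | h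
  · exact key₁ _ rfl (Or.inl h)
  · exact key₂ _ rfl (Or.inl h)
  · exact key₁ _ rfl (Or.inr (Or.inl h))
  · exact key₂ _ rfl (Or.inr (Or.inl h))
  · exact key₁ _ rfl (Or.inr (Or.inr h))
  · exact key₂ _ rfl (Or.inr (Or.inr h))

/-- **The Hodge conjecture for all powers of an abelian variety of Ribet type with coprime multiplicities,
`min(n′, n″) ≤ 7` or a multiplicity in `{11, 13}` — UNCONDITIONAL.** [cite: Ribet1983, Thm. 3] [cite: Deligne2000, §1] -/
theorem hodgeConjectureFor_powSucc_of_ribetType_coprime_min_le_seven_or_mem (A : AbelianVariety ℂ)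
    (φ : A ⟶ A) {d : ℕ} (hd : 0 < d) (hφ : φ ≫ φ = -(d • 𝟙 A)) (hE2 : Module.finrank ℚ A.endAlgebra = 2)
    (hdim : 3 ≤ A.dim)
    (hcop : Nat.Coprime (eigenMultiplicity A φ (Complex.I * (Real.sqrt d : ℂ)))
      (eigenMultiplicity A φ (-(Complex.I * (Real.sqrt d : ℂ)))))
    (hmin : eigenMultiplicity A φ (Complex.I * (Real.sqrt d : ℂ)) ≤ 7 ∨
      eigenMultiplicity A φ (-(Complex.I * (Real.sqrt d : ℂ))) ≤ 7 ∨
      eigenMultiplicity A φ (Complex.I * (Real.sqrt d : ℂ)) = 11 ∨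
      eigenMultiplicity A φ (-(Complex.I * (Real.sqrt d : ℂ))) = 11 ∨
      eigenMultiplicity A φ (Complex.I * (Real.sqrt d : ℂ)) = 13 ∨
      eigenMultiplicity A φ (-(Complex.I * (Real.sqrt d : ℂ))) = 13) (N : ℕ) :
    HodgeConjectureFor (A.powSucc N).dim (A.powSucc N).X :=
  hodgeConjectureFor_of_isDivisorGenerated _
    (AbelianVariety.isDivisorGenerated_powSucc_of_ribetType_coprime_min_le_seven_or_mem A φ hd hφ hE2 hdim hcop hmin N)

end Packaged

end Literature.AlgebraicGeometry.HodgeTheory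

end
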